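import Literature.Analysis.FluidPDE.TorusNSVDataExistenceLimits
import Literature.Analysis.FluidPDE.TorusLinearisedNSH1Balance
import Literature.Analysis.FunctionSpaces.TorusLinearisedNSGrowth
import Literature.Analysis.FunctionSpaces.TorusGevreyCompactness
import HarnessLib

/-!
# Elementary tools for the construction of solutions of the linearised Navier–Stokes equation
# on `T^d` from `V`-data by smooth approximation

Analysis/FluidPDE proof file (theorems only; no definitions, no named facts). Small lemmas used by
`TorusLinearisedNSVData*` (the LINEAR twin of `TorusNSVDataExistence*`: solutions of the linearised
equation `∂ₜw + (u·∇)w + (w·∇)u = νΔw − ∇q`, `div w = 0`, along a smooth background `u`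
(Constantin–Foias 1988, Ch. 14, (14.2)–(14.4)) issued from `H¹` data as limits of the solutions
issued from the truncations `P_N v₀`):

* `Torus.integral_norm_sq_add_gradNormSq_le_of_tendsto` — an `H¹`-level bound
  `∫ ‖cₘ‖² + ‖∇cₘ‖₂² ≤ B` passes to `H¹`-limits (weighted parallelogram bounds, `ε → 0⁺`);
* `Torus.tendsto_h1_of_h1DistSq_le_mul` — a rate `d(v_N, w)² ≤ Cε_N`, `ε_N → 0`, gives convergence
  in `L²` and in `Ḣ¹`;
* `Torus.exists_smooth_h1Limit_of_gevreyBound` — an `H¹`-Cauchy sequence of smooth divergence-free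
  mean-zero fields under a uniform Gevrey bound has a smooth divergence-free mean-zero `H¹`-limit,
  with the rate of the full sequence (compactness of Gevrey balls,
  `Torus.exists_smooth_limit_of_gevrey_bound`, and `Torus.h1DistSq_le_of_tendsto`);
* `Torus.linearisedNS_exists_h1GrowthRate` — ONE rate `K ≥ 0` (from the sup norms of `u`, `∂ᵢu` on
  the compact window) such that every solution of the linearised equation along `u` on every
  sub-window `[s, b] ⊆ [a, b]` obeys `∫ ‖w(t)‖² + ‖∇w(t)‖₂² ≤ (∫ ‖w(s)‖² + ‖∇w(s)‖₂²) e^{K(t−s)}`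
  (`Torus.linearisedNS_h1_le_mul_exp`);
* locality on `(a, b]`: joint smoothness from smooth windows
  (`Torus.isSmoothSpaceTimeOn_Ioc_of_forall_exists_window`, Mathlib `contDiffOn_of_locally_contDiffOn`)
  and the one-sided time derivative within `(a, b]` read off a window
  (`Torus.timeDerivWithin_Ioc_eq_of_window`, Mathlib `derivWithin_inter`);
* `Torus.eq_of_forall_sub_eq_of_hasZeroMean` — mean-zero functions with the same increments agree
  (normalisation of the pressures of two windows).

References: P. Constantin, C. Foias, *Navier–Stokes Equations*, Univ. Chicago Press 1988, Ch. 14.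
[ConstantinFoiasNSE1988]  J. C. Robinson, J. L. Rodrigo, W. Sadowski, *The Three-Dimensional
Navier–Stokes Equations*, CUP 2016, Thm 6.8 (the approximation scheme). [RobinsonRodrigoSadowskiCUP2016]
-/

noncomputable section

open MeasureTheory Set Function Filter UnitAddTorus
open scoped ContDiff InnerProductSpace Topology ENNReal

namespace Literature.Analysis.FluidPDE

open Literature.Analysis.FunctionSpaces

variable {d : Type*} [Fintype d] [DecidableEq d]

/-! ### `H¹`-level bounds pass to `H¹`-limits -/

omit [DecidableEq d] in
/-- Weighted parallelogram bound in `L²` for continuous fields: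
`ε ∫ ‖f + g‖² ≤ ε(1 + ε) ∫ ‖f‖² + (1 + ε) ∫ ‖g‖²` for `ε ≥ 0`. [folklore] -/
theorem Torus.mul_integral_norm_sq_add_le {f g : UnitAddTorus d → EuclideanSpace ℝ d}
    (hf : Continuous f) (hg : Continuous g) {ε : ℝ} (hε : 0 ≤ ε) :
    ε * ∫ x, ‖f x + g x‖ ^ 2 ≤ ε * (1 + ε) * (∫ x, ‖f x‖ ^ 2) + (1 + ε) * ∫ x, ‖g x‖ ^ 2 := by
  have hif : Integrable (fun x => ‖f x‖ ^ 2) volume := ((hf.norm).pow 2).integrable_unitAddTorus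
  have hig : Integrable (fun x => ‖g x‖ ^ 2) volume := ((hg.norm).pow 2).integrable_unitAddTorus
  have hifg : Integrable (fun x => ‖f x + g x‖ ^ 2) volume :=
    (((hf.add hg).norm).pow 2).integrable_unitAddTorus
  have hsq : ∀ x, ε * ‖f x + g x‖ ^ 2 ≤ ε * (1 + ε) * ‖f x‖ ^ 2 + (1 + ε) * ‖g x‖ ^ 2 := fun x => by
    have h1 : ‖f x + g x‖ ^ 2 ≤ (‖f x‖ + ‖g x‖) ^ 2 :=
      pow_le_pow_left₀ (norm_nonneg _) (norm_add_le _ _) 2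
    have h2 : ε * ‖f x + g x‖ ^ 2 ≤ ε * (‖f x‖ + ‖g x‖) ^ 2 := mul_le_mul_of_nonneg_left h1 hε
    nlinarith [sq_nonneg (ε * ‖f x‖ - ‖g x‖)]
  calc ε * ∫ x, ‖f x + g x‖ ^ 2 = ∫ x, ε * ‖f x + g x‖ ^ 2 := (integral_const_mul _ _).symm
    _ ≤ ∫ x, (ε * (1 + ε) * ‖f x‖ ^ 2 + (1 + ε) * ‖g x‖ ^ 2) :=
        integral_mono (hifg.const_mul ε) ((hif.const_mul _).add (hig.const_mul _)) hsq
    _ = ε * (1 + ε) * (∫ x, ‖f x‖ ^ 2) + (1 + ε) * ∫ x, ‖g x‖ ^ 2 := by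
        rw [integral_add (hif.const_mul _) (hig.const_mul _), integral_const_mul, integral_const_mul]

/-- **An `H¹`-level bound passes to `H¹`-limits**: if `∫ ‖cₘ‖² + ‖∇cₘ‖₂² ≤ B` for all `m` and
`cₘ → w` in `L²` and in `Ḣ¹`, all fields smooth, then `∫ ‖w‖² + ‖∇w‖₂² ≤ B` (the weighted
parallelogram bounds `Torus.mul_integral_norm_sq_add_le`, `Torus.mul_gradNormSq_add_le` with
`w = cₘ + (w − cₘ)`, `m → ∞`, then `ε → 0⁺`). [folklore] -/
theorem Torus.integral_norm_sq_add_gradNormSq_le_of_tendsto {c : ℕ → UnitAddTorus d → EuclideanSpace ℝ d}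
    {w : UnitAddTorus d → EuclideanSpace ℝ d} (hc : ∀ m, Torus.IsSmooth (c m)) (hw : Torus.IsSmooth w)
    {B : ℝ} (hB : ∀ m, (∫ x, ‖c m x‖ ^ 2) + Torus.gradNormSq (c m) ≤ B)
    (hL2 : Tendsto (fun m => ∫ x, ‖c m x - w x‖ ^ 2) atTop (𝓝 0))
    (hH1 : Tendsto (fun m => Torus.gradNormSq (fun x => c m x - w x)) atTop (𝓝 0)) :
    (∫ x, ‖w x‖ ^ 2) + Torus.gradNormSq w ≤ B := by
  -- adapted from `Torus.gradNormSq_le_of_tendsto` (`TorusNSVDataExistenceLimits`)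
  set P : (UnitAddTorus d → EuclideanSpace ℝ d) → ℝ := fun f => (∫ x, ‖f x‖ ^ 2) + Torus.gradNormSq f
    with hP_def
  have hB0 : 0 ≤ B :=
    (add_nonneg (integral_nonneg fun x => sq_nonneg _) (Torus.gradNormSq_nonneg _)).trans (hB 0)
  have hL2' : Tendsto (fun m => ∫ x, ‖w x - c m x‖ ^ 2) atTop (𝓝 0) := by
    refine hL2.congr fun m => ?_
    exact Torus.integral_norm_sub_sq_comm _ _
  have hH1' : Tendsto (fun m => Torus.gradNormSq (fun x => w x - c m x)) atTop (𝓝 0) := by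
    refine hH1.congr fun m => ?_
    exact Torus.gradNormSq_sub_comm _ _
  have hε : ∀ ε : ℝ, 0 < ε → P w ≤ (1 + ε) * B := by
    intro ε hε
    have hle : ∀ m, ε * P w ≤ ε * (1 + ε) * B + (1 + ε) * P (fun x => w x - c m x) := by
      intro m
      have hg : Torus.IsSmooth (fun x => w x - c m x) := hw.sub (hc m)
      have h1 := Torus.mul_integral_norm_sq_add_le (hc m).continuous hg.continuous hε.le
        (f := c m) (g := fun x => w x - c m x)
      have h2 := Torus.mul_gradNormSq_add_le (hc m) hg hε.le (f := c m) (g := fun x => w x - c m x)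
      have he : (c m + fun x => w x - c m x) = w := by
        funext x
        simp
      have he' : ∀ x, c m x + (w x - c m x) = w x := fun x => by simp
      simp only [he'] at h1
      rw [he] at h2
      have h3 : ε * (1 + ε) * P (c m) ≤ ε * (1 + ε) * B :=
        mul_le_mul_of_nonneg_left (hB m) (by positivity)
      simp only [hP_def] at h3 ⊢
      nlinarith [h1, h2, h3]
    have hlim : Tendsto (fun m => ε * (1 + ε) * B + (1 + ε) * P (fun x => w x - c m x)) atTop
        (𝓝 (ε * (1 + ε) * B)) := by
      have h := ((hL2'.add hH1').const_mul (1 + ε)).const_add (ε * (1 + ε) * B)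
      simpa [hP_def] using h
    have h := ge_of_tendsto' hlim hle
    have h' : ε * P w ≤ ε * ((1 + ε) * B) := by linarith
    exact le_of_mul_le_mul_left h' hε
  have hlim : Tendsto (fun ε : ℝ => (1 + ε) * B) (𝓝[>] 0) (𝓝 B) := by
    have h : Tendsto (fun ε : ℝ => (1 + ε) * B) (𝓝 0) (𝓝 ((1 + 0) * B)) :=
      ((continuous_const.add continuous_id).mul continuous_const).tendsto 0
    rw [add_zero, one_mul] at h
    exact h.mono_left nhdsWithin_le_nhds
  exact ge_of_tendsto hlim (eventually_nhdsWithin_of_forall fun ε hε0 => hε ε hε0)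

/-- A rate `∫ ‖v_N − w‖² + ‖∇(v_N − w)‖₂² ≤ C ε_N` with `ε_N → 0` gives convergence of `v_N` to `w`
in `L²` and in `Ḣ¹` (both parts are nonnegative). [folklore] -/
theorem Torus.tendsto_h1_of_h1DistSq_le_mul {v : ℕ → UnitAddTorus d → EuclideanSpace ℝ d}
    {w : UnitAddTorus d → EuclideanSpace ℝ d} {C : ℝ} {ε : ℕ → ℝ} (hε : Tendsto ε atTop (𝓝 0))
    (h : ∀ N, (∫ x, ‖v N x - w x‖ ^ 2) + Torus.gradNormSq (fun x => v N x - w x) ≤ C * ε N) :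
    Tendsto (fun N => ∫ x, ‖v N x - w x‖ ^ 2) atTop (𝓝 0) ∧
      Tendsto (fun N => Torus.gradNormSq (fun x => v N x - w x)) atTop (𝓝 0) := by
  have hlim : Tendsto (fun N => C * ε N) atTop (𝓝 0) := by simpa using hε.const_mul C
  have h0 : ∀ N, 0 ≤ ∫ x, ‖v N x - w x‖ ^ 2 := fun N => integral_nonneg fun x => sq_nonneg _
  have h0' : ∀ N, 0 ≤ Torus.gradNormSq (fun x => v N x - w x) := fun N => Torus.gradNormSq_nonneg _
  refine ⟨tendsto_of_tendsto_of_tendsto_of_le_of_le tendsto_const_nhds hlim h0 fun N => ?_,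
    tendsto_of_tendsto_of_tendsto_of_le_of_le tendsto_const_nhds hlim h0' fun N => ?_⟩
  · linarith [h N, h0' N]
  · linarith [h N, h0 N]

/-! ### Smooth `H¹`-limits under a uniform Gevrey bound -/

/-- **Smooth `H¹`-limit of an `H¹`-Cauchy sequence under a uniform Gevrey bound.** Let
`v_N : T^d → ℝ^d` be smooth, divergence free and mean zero with
`∑_{k∈S} e^{2σ|k|}‖𝓕(v_N)(k)‖² ≤ C_g` (`σ > 0`, all finite `S`) and
`∫ ‖v_N − v_M‖² + ‖∇(v_N − v_M)‖₂² ≤ C(ε_N + ε_M)` with `ε_N → 0`. Then there is a smooth,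
divergence-free, mean-zero `w` with `∫ ‖v_N − w‖² + ‖∇(v_N − w)‖₂² ≤ 2Cε_N` for ALL `N`
(a subsequence converges in `H¹` to such a `w` by compactness of Gevrey balls,
`Torus.exists_smooth_limit_of_gevrey_bound`; the pairwise bound passes to the limit,
`Torus.h1DistSq_le_of_tendsto`). [folklore] -/
theorem Torus.exists_smooth_h1Limit_of_gevreyBound {σ Cg C : ℝ} (hσ : 0 < σ)
    {v : ℕ → UnitAddTorus d → EuclideanSpace ℝ d} (hv : ∀ N, Torus.IsSmooth (v N))
    (hdiv : ∀ N, Torus.IsDivFree (v N)) (hmean : ∀ N, Torus.HasZeroMean (v N))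
    (hG : ∀ N, ∀ S : Finset (d → ℤ), ∑ k ∈ S, Real.exp (2 * σ * Real.sqrt (Torus.freqNormSq k)) *
      ‖mFourierCoeff (EuclideanSpace.complexify ∘ v N) k‖ ^ 2 ≤ Cg)
    {ε : ℕ → ℝ} (hε : Tendsto ε atTop (𝓝 0))
    (hpair : ∀ N M, (∫ x, ‖v N x - v M x‖ ^ 2) + Torus.gradNormSq (fun x => v N x - v M x) ≤
      C * (ε N + ε M)) :
    ∃ w : UnitAddTorus d → EuclideanSpace ℝ d, Torus.IsSmooth w ∧ Torus.IsDivFree w ∧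
      Torus.HasZeroMean w ∧
      ∀ N, (∫ x, ‖v N x - w x‖ ^ 2) + Torus.gradNormSq (fun x => v N x - w x) ≤ 2 * C * ε N := by
  -- adapted from the first step of `Torus.exists_limit_slices_of_h1Cauchy` (`TorusNSVDataExistenceApprox`)
  obtain ⟨w, ψ, hψ, hw, hwdiv, hwmean, -, hL2, hH1⟩ :=
    Torus.exists_smooth_limit_of_gevrey_bound hσ v hv hdiv hmean hG
  refine ⟨w, hw, hwdiv, hwmean, fun N => ?_⟩
  have hδ : Tendsto (fun m => C * ε (ψ m)) atTop (𝓝 0) := by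
    simpa using (hε.comp hψ.tendsto_atTop).const_mul C
  have h := Torus.h1DistSq_le_of_tendsto (hv N) (fun m => hv (ψ m)) hw (B := C * ε N)
    (δ := fun m => C * ε (ψ m)) (c := fun m => v (ψ m))
    (fun m => by have h1 := hpair N (ψ m); linarith) hδ hL2 hH1
  linarith

/-! ### One exponential `H¹` rate for the linearised equation on all sub-windows -/

/-- **One `H¹` growth rate for the linearised equation along `u` on all sub-windows.** For
`ν > 0`, `a < b` and `u` jointly smooth on `[a, b] × T^d` with divergence-free slices there is
`K ≥ 0` (from `sup ‖u‖`, `sup ‖∂ᵢu‖` on the compact window) such that for every `s ≥ a` and every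
jointly smooth `(w, q)` on `[s, b] × T^d` with `div w(t) = 0` solving
`∂ₜw + (u·∇)w + (w·∇)u = νΔw − ∇q` (one-sided time derivative within `[s, b]`),
`∫ ‖w(t)‖² + ‖∇w(t)‖₂² ≤ (∫ ‖w(s)‖² + ‖∇w(s)‖₂²) e^{K(t − s)}` for `t ∈ [s, b]`
(`Torus.linearisedNS_h1_le_mul_exp`; Constantin–Foias 1988, Ch. 14: the solution operator of the
first variation equation is bounded on `V`, uniformly along the trajectory segment). [folklore] -/
theorem Torus.linearisedNS_exists_h1GrowthRate {ν a b : ℝ} (hν : 0 < ν) (hab : a < b)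
    {u : ℝ → UnitAddTorus d → EuclideanSpace ℝ d} (hu : Torus.IsSmoothSpaceTimeOn (Icc a b) u)
    (hudiv : ∀ t ∈ Icc a b, Torus.IsDivFree (u t)) :
    ∃ K : ℝ, 0 ≤ K ∧ ∀ {s : ℝ}, a ≤ s → ∀ {w : ℝ → UnitAddTorus d → EuclideanSpace ℝ d}
      {q : ℝ → UnitAddTorus d → ℝ}, Torus.IsSmoothSpaceTimeOn (Icc s b) w →
      Torus.IsSmoothSpaceTimeOn (Icc s b) q → (∀ t ∈ Icc s b, Torus.IsDivFree (w t)) →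
      (∀ t ∈ Icc s b, ∀ x, Torus.timeDerivWithin (Icc s b) w t x + Torus.convect (u t) (w t) x +
        Torus.convect (w t) (u t) x = ν • Torus.laplacian (w t) x - Torus.gradient (q t) x) →
      ∀ t ∈ Icc s b, (∫ x, ‖w t x‖ ^ 2) + Torus.gradNormSq (w t) ≤
        ((∫ x, ‖w s x‖ ^ 2) + Torus.gradNormSq (w s)) * Real.exp (K * (t - s)) := by
  have hU : UniqueDiffOn ℝ (Icc a b) := uniqueDiffOn_Icc hab
  obtain ⟨M, hM⟩ := hu.exists_norm_le_of_isCompact isCompact_Icc subset_rfl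
  have hbd : ∀ i : d, ∃ c : ℝ, ∀ t ∈ Icc a b, ∀ x, ‖Torus.partialDeriv i (u t) x‖ ≤ c := fun i =>
    (hu.partialDeriv hU i).exists_norm_le_of_isCompact isCompact_Icc subset_rfl
  choose C hC using hbd
  set K' : ℝ := 2 * ∑ i, C i + ((∑ i, C i) ^ 2 + (Fintype.card d) * M ^ 2) / ν with hK'
  refine ⟨max K' 0, le_max_right _ _, fun {s} hs {w q} hw hq hwdiv hlin t ht => ?_⟩
  have hsub : Icc s b ⊆ Icc a b := Icc_subset_Icc hs le_rfl
  have h := Torus.linearisedNS_h1_le_mul_exp hν (hu.mono hsub) (fun r hr => hudiv r (hsub hr)) hw hq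
    hwdiv hlin (fun r hr x => hM r (hsub hr) x) (fun i r hr x => hC i r (hsub hr) x) ht
  refine h.trans (mul_le_mul_of_nonneg_left ?_ ?_)
  · exact Real.exp_le_exp.2 (mul_le_mul_of_nonneg_right (le_max_left _ _) (by linarith [ht.1]))
  · exact add_nonneg (integral_nonneg fun x => sq_nonneg _) (Torus.gradNormSq_nonneg _)

/-! ### Locality on `(a, b]`: smoothness and time derivatives from windows; pressures -/

omit [DecidableEq d] in
/-- **Joint smoothness on `(a, b]` is read off windows.** If every `t ∈ (a, b]` admits `s` with
`a ≤ s < t` and a field `W` jointly smooth on `[s, b] × T^d` agreeing with `w` on `(s, b]`, then `w`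
is jointly smooth on `(a, b] × T^d` (Mathlib `contDiffOn_of_locally_contDiffOn` with the open sets
`(s, ∞) × ℝ^d`). [folklore] -/
theorem Torus.isSmoothSpaceTimeOn_Ioc_of_forall_exists_window {F : Type*} [NormedAddCommGroup F]
    [NormedSpace ℝ F] {a b : ℝ} {w : ℝ → UnitAddTorus d → F}
    (h : ∀ t ∈ Ioc a b, ∃ s : ℝ, a ≤ s ∧ s < t ∧ ∃ W : ℝ → UnitAddTorus d → F,
      Torus.IsSmoothSpaceTimeOn (Icc s b) W ∧ ∀ r ∈ Ioc s b, W r = w r) :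
    Torus.IsSmoothSpaceTimeOn (Ioc a b) w := by
  refine contDiffOn_of_locally_contDiffOn fun z hz => ?_
  obtain ⟨t, y⟩ := z
  obtain ⟨s, has, hst, W, hW, heq⟩ := h t (mem_prod.1 hz).1
  refine ⟨Ioi s ×ˢ univ, isOpen_Ioi.prod isOpen_univ, ⟨hst, mem_univ _⟩, ?_⟩
  have hset : (Ioc a b ×ˢ (univ : Set (EuclideanSpace ℝ d))) ∩ Ioi s ×ˢ univ = Ioc s b ×ˢ univ := by
    rw [prod_inter_prod, inter_self]
    congr 1
    ext r
    simp only [mem_inter_iff, mem_Ioc, mem_Ioi]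
    constructor
    · rintro ⟨⟨-, h2⟩, h3⟩
      exact ⟨h3, h2⟩
    · rintro ⟨h1, h2⟩
      exact ⟨⟨has.trans_lt h1, h2⟩, h1⟩
  rw [hset]
  exact (ContDiffOn.mono hW (prod_mono Ioc_subset_Icc_self subset_rfl)).congr fun z hz => by
    obtain ⟨τ, y'⟩ := z
    simp only [Torus.stLift_apply, heq τ (mem_prod.1 hz).1]

omit [DecidableEq d] in
/-- **The time derivative within `(a, b]` is read off a window.** If `W` is jointly smooth on
`[s, b] × T^d`, `a ≤ s < t ≤ b`, and `W = w` on `(s, b]`, then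
`∂ₜw` within `(a, b]` at `t` equals `∂ₜW` within `[s, b]` at `t` (the derivative within `(a, b]`
only sees `(a, b] ∩ (s, ∞) = (s, b]`, Mathlib `derivWithin_inter`, `derivWithin_congr`, and
`Torus.IsSmoothSpaceTimeOn.timeDerivWithin_eq_of_subset`). [folklore] -/
theorem Torus.timeDerivWithin_Ioc_eq_of_window {F : Type*} [NormedAddCommGroup F] [NormedSpace ℝ F]
    {a b s t : ℝ} {w W : ℝ → UnitAddTorus d → F} (has : a ≤ s) (hst : s < t) (htb : t ≤ b)
    (hW : Torus.IsSmoothSpaceTimeOn (Icc s b) W) (heq : ∀ r ∈ Ioc s b, W r = w r) (x : UnitAddTorus d) :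
    Torus.timeDerivWithin (Ioc a b) w t x = Torus.timeDerivWithin (Icc s b) W t x := by
  have hset : Ioc a b ∩ Ioi s = Ioc s b := by
    ext r
    simp only [mem_inter_iff, mem_Ioc, mem_Ioi]
    constructor
    · rintro ⟨⟨-, h2⟩, h3⟩
      exact ⟨h3, h2⟩
    · rintro ⟨h1, h2⟩
      exact ⟨⟨has.trans_lt h1, h2⟩, h1⟩
  have ht : t ∈ Ioc s b := ⟨hst, htb⟩
  have h1 : Torus.timeDerivWithin (Ioc a b) w t x = Torus.timeDerivWithin (Ioc s b) w t x := by
    simp only [Torus.timeDerivWithin]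
    rw [← derivWithin_inter (Ioi_mem_nhds hst), hset]
  have h2 : Torus.timeDerivWithin (Ioc s b) w t x = Torus.timeDerivWithin (Ioc s b) W t x :=
    (Torus.timeDerivWithin_congr_of_eqOn heq ht x).symm
  rw [h1, h2, hW.timeDerivWithin_eq_of_subset Ioc_subset_Icc_self (uniqueDiffOn_Ioc s b) ht x]

omit [DecidableEq d] in
/-- **Mean-zero functions with the same increments agree**: if `q₁ x − q₁ x₀ = q₂ x − q₂ x₀` for
all `x, x₀` (e.g. two pressures with the same gradient, `Torus.linearisedNS_pressure_sub_eq`) and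
both are integrable with zero mean, then `q₁ = q₂` (integrate in `x` over the probability space
`T^d`). [folklore] -/
theorem Torus.eq_of_forall_sub_eq_of_hasZeroMean {q₁ q₂ : UnitAddTorus d → ℝ}
    (hq₁ : Integrable q₁ volume) (hq₂ : Integrable q₂ volume) (h₁ : Torus.HasZeroMean q₁)
    (h₂ : Torus.HasZeroMean q₂) (h : ∀ x x₀, q₁ x - q₁ x₀ = q₂ x - q₂ x₀) : q₁ = q₂ := by
  funext x₀
  have hint : ∫ x, (q₁ x - q₁ x₀) = ∫ x, (q₂ x - q₂ x₀) := integral_congr_ae (ae_of_all _ fun x => h x x₀)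
  rw [integral_sub hq₁ (integrable_const _), integral_sub hq₂ (integrable_const _), integral_const,
    integral_const] at hint
  unfold Torus.HasZeroMean at h₁ h₂
  rw [h₁, h₂] at hint
  simpa using hint

end Literature.Analysis.FluidPDE

end
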